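import Mathlib.Analysis.Convex.Deriv
import Mathlib.Analysis.Convex.SpecificFunctions.Basic
import Literature.NumberTheory.LFunctions.ZetaScrew
import HarnessLib

/-!
# Prime-side semiconcavity of Suzuki's screw function `Ψ`

`Ψ = zetaScrew` is Suzuki's screw function of `ζ` (Suzuki2023 (1.1), tree `zetaScrew`,
`zetaScrew_eq`): for `t ≥ 0`,

  `Ψ(t) = 4(e^{t/2} + e^{-t/2} - 2) - c₀ t/2 + C/4 - φ(t) - ¼ e^{-t/2} Φ(e^{-2t}, 2, ¼)`,

with the prime hinge sum `φ(t) = ∑_{n ≤ e^t} Λ(n) n^{-1/2} (t - log n)` (`zetaScrewPrimeSum`) and the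
Hurwitz–Lerch term `e^{-t/2} Φ = ∑_k e^{-(2k+½)t} (k+¼)^{-2}` (`hurwitzLerchQuarter`).  The first
bracket is smooth with second derivative `e^{t/2} + e^{-t/2}`, while `φ` and the Hurwitz–Lerch term
are CONVEX.  Hence `Ψ` is SEMICONCAVE on every window `[a, b] ⊆ [0, ∞)` with modulus
`M ≥ e^{b/2} + 1`: `t ↦ Ψ(t) - M t²/2` is concave there (`concaveOn_zetaScrew_sub_quad`), which
gives the one-sided Taylor bound `Ψ(t) ≤ Ψ(t₀) + p (t - t₀) + ½ M (t - t₀)²` at every interior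
point (`zetaScrew_le_taylor_of_mem_Ioo`) and the WIDTH LAW of negative excursions
(`zetaScrew_excursion_window_of_mem`): a dip `Ψ(t₀) ≤ -2D` keeps `Ψ ≤ -D` on a one-sided window
of length `√(2D/M)` next to `t₀`.

This is the route-independent (Literature-side, no `Theses` import) home of the semiconcavity
by-products of the rh-split screw line L22 (route ScrewQuarticNodes, desk rh-idea-9; first landed
inside `Summits/…/Theorems/ScrewQuarticNodesSparseNodeDoor.lean` by prover-l22 g0 for the unit
window `[t₀-1, t₀+1]` — the convexity lemmas below are adapted from that file; the window is
generalised to any `[a, b] ⊆ [0, ∞)` and any interior base point).  All statements are elementary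
consequences of Suzuki's explicit formula (1.1); they are RH-free real analysis and nothing here
bears on the truth of RH.

## Contents (all proved; no definitions, no named facts)

* `concaveOn_arch_sub_quad` — the archimedean bracket minus `M t²/2` is concave on `[a, b]` for
  `0 ≤ a`, `e^{b/2} + 1 ≤ M`;
* `convexOn_zetaScrewPrimeSum` — `φ` is convex on `[0, b]`;
* `convexOn_exp_mul_hurwitzLerchQuarter` — the Hurwitz–Lerch term is convex on `[0, ∞)`;
* `concaveOn_zetaScrew_sub_quad` — semiconcavity of `Ψ` on `[a, b]`;
* (private) `exists_supergradient_of_concaveOn` — supergradients of concave functions at interior points;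
* `zetaScrew_le_taylor_of_mem_Ioo` — the one-sided Taylor bound at an interior `t₀ ∈ (a, b)`;
* `zetaScrew_excursion_window_of_mem` — the width law.

## References

* M. Suzuki, *Aspects of the screw function corresponding to the Riemann zeta-function*, J. Lond.
  Math. Soc. (2) 108 (2023) 1448–1487; arXiv:2206.03682, (1.1) and Prop. 2.1. [Suzuki2023]
-/

noncomputable section

open Real Set Filter Topology

namespace Literature.NumberTheory.LFunctions

namespace ZetaScrewSemiconcave

/-! ## Convexity of the pieces of `Ψ` -/

/-- The archimedean-plus-affine part of `Ψ` minus the quadratic `M t²/2` is concave on `[a, b]`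
as soon as `0 ≤ a` and `e^{b/2} + 1 ≤ M` (its second derivative is `e^{t/2} + e^{-t/2} - M ≤ 0`
there). [cite: Suzuki2023, (1.1)] -/
theorem concaveOn_arch_sub_quad {a b M : ℝ} (α β : ℝ) (ha : 0 ≤ a)
    (hM : Real.exp (b / 2) + 1 ≤ M) :
    ConcaveOn ℝ (Icc a b) (fun t : ℝ =>
      4 * (Real.exp (t / 2) + Real.exp (-(t / 2)) - 2) + α * t + β - M / 2 * t ^ 2) := by
  set f : ℝ → ℝ := fun t =>
    4 * (Real.exp (t / 2) + Real.exp (-(t / 2)) - 2) + α * t + β - M / 2 * t ^ 2 with hf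
  set f' : ℝ → ℝ := fun t => 2 * Real.exp (t / 2) - 2 * Real.exp (-(t / 2)) + α - M * t with hf'
  set f'' : ℝ → ℝ := fun t => Real.exp (t / 2) + Real.exp (-(t / 2)) - M with hf''
  have hd1 : ∀ t, HasDerivAt f (f' t) t := by
    intro t
    have h1 : HasDerivAt (fun x : ℝ => Real.exp (x / 2)) (Real.exp (t / 2) * (1 / 2)) t :=
      ((hasDerivAt_id' t).div_const 2).exp
    have h2 : HasDerivAt (fun x : ℝ => Real.exp (-(x / 2))) (Real.exp (-(t / 2)) * (-(1 / 2))) t :=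
      ((hasDerivAt_id' t).div_const 2).neg.exp
    have h3 : HasDerivAt (fun x : ℝ => α * x) (α * 1) t := (hasDerivAt_id' t).const_mul α
    have h4 : HasDerivAt (fun x : ℝ => M / 2 * x ^ 2) (M / 2 * ((2 : ℕ) * t ^ (2 - 1))) t :=
      (hasDerivAt_pow 2 t).const_mul (M / 2)
    have h : HasDerivAt f (4 * (Real.exp (t / 2) * (1 / 2) + Real.exp (-(t / 2)) * (-(1 / 2)))
        + α * 1 - M / 2 * ((2 : ℕ) * t ^ (2 - 1))) t :=
      ((((h1.add h2).sub_const 2).const_mul 4).add h3).add_const β |>.sub h4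
    refine h.congr_deriv ?_
    simp only [hf']
    push_cast
    ring
  have hd2 : ∀ t, HasDerivAt f' (f'' t) t := by
    intro t
    have h1 : HasDerivAt (fun x : ℝ => Real.exp (x / 2)) (Real.exp (t / 2) * (1 / 2)) t :=
      ((hasDerivAt_id' t).div_const 2).exp
    have h2 : HasDerivAt (fun x : ℝ => Real.exp (-(x / 2))) (Real.exp (-(t / 2)) * (-(1 / 2))) t :=
      ((hasDerivAt_id' t).div_const 2).neg.exp
    have h3 : HasDerivAt (fun x : ℝ => M * x) (M * 1) t := (hasDerivAt_id' t).const_mul M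
    have h : HasDerivAt f' (2 * (Real.exp (t / 2) * (1 / 2)) - 2 * (Real.exp (-(t / 2)) * (-(1 / 2)))
        - M * 1) t :=
      (((h1.const_mul 2).sub (h2.const_mul 2)).add_const α).sub h3
    refine h.congr_deriv ?_
    simp only [hf'']
    ring
  refine concaveOn_of_hasDerivWithinAt2_nonpos (convex_Icc a b) (f' := f') (f'' := f'')
    (fun t _ => (hd1 t).continuousAt.continuousWithinAt)
    (fun t _ => (hd1 t).hasDerivWithinAt) (fun t _ => (hd2 t).hasDerivWithinAt) ?_
  intro t ht
  rw [interior_Icc] at ht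
  have h1 : Real.exp (t / 2) ≤ Real.exp (b / 2) := Real.exp_le_exp.2 (by linarith [ht.2])
  have h2 : Real.exp (-(t / 2)) ≤ 1 := by
    rw [Real.exp_le_one_iff]
    linarith [ht.1]
  simp only [hf'']
  linarith

/-- Hinge inequality: for `a, b ≥ 0`, `a + b = 1`,
`max (a x + b y - L) 0 ≤ a · max (x - L) 0 + b · max (y - L) 0`. [folklore] -/
private theorem max_sub_zero_convex_ineq (x y L a b : ℝ) (ha : 0 ≤ a) (hb : 0 ≤ b) (hab : a + b = 1) :
    max (a * x + b * y - L) 0 ≤ a * max (x - L) 0 + b * max (y - L) 0 := by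
  refine max_le ?_ ?_
  · have h1 := mul_le_mul_of_nonneg_left (le_max_left (x - L) 0) ha
    have h2 := mul_le_mul_of_nonneg_left (le_max_left (y - L) 0) hb
    have h5 : a * x + b * y - L = a * (x - L) + b * (y - L) := by linear_combination L * hab
    rw [h5]
    exact add_le_add h1 h2
  · have h1 : 0 ≤ max (x - L) 0 := le_max_right _ _
    have h2 : 0 ≤ max (y - L) 0 := le_max_right _ _
    positivity

/-- The prime hinge sum `φ(t) = ∑_{n ≤ e^{t}} Λ(n) n^{-1/2} (t - log n)` is convex on every `[0, b]`
(there it is the finite sum `∑_{n ≤ ⌈e^b⌉} Λ(n) n^{-1/2} max(t - log n, 0)` of convex hinges; `φ` is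
the prime sum of Suzuki2023 (1.1) / Prop. 2.1). [cite: Suzuki2023, (1.1)] -/
theorem convexOn_zetaScrewPrimeSum (b : ℝ) : ConvexOn ℝ (Icc 0 b) zetaScrewPrimeSum := by
  set M : ℕ := ⌈Real.exp b⌉₊ with hM
  have heq : EqOn (fun t : ℝ => ∑ n ∈ Finset.Icc 1 M,
      ArithmeticFunction.vonMangoldt n / Real.sqrt n * max (t - Real.log n) 0)
      zetaScrewPrimeSum (Icc 0 b) := by
    intro t ht
    have habs : |t| = t := abs_of_nonneg ht.1
    have hle : Real.exp |t| ≤ M := by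
      rw [habs]
      exact (Real.exp_le_exp.2 ht.2).trans (Nat.le_ceil _)
    rw [zetaScrewPrimeSum_eq_sum_max hle, habs]
  refine ConvexOn.congr ?_ heq
  refine ⟨convex_Icc 0 b, fun x _ y _ a c ha hc hac => ?_⟩
  simp only [smul_eq_mul]
  rw [Finset.mul_sum, Finset.mul_sum, ← Finset.sum_add_distrib]
  refine Finset.sum_le_sum fun n _ => ?_
  have hc0 : 0 ≤ (ArithmeticFunction.vonMangoldt n : ℝ) / Real.sqrt n :=
    div_nonneg ArithmeticFunction.vonMangoldt_nonneg (Real.sqrt_nonneg _)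
  have h := max_sub_zero_convex_ineq x y (Real.log n) a c ha hc hac
  calc (ArithmeticFunction.vonMangoldt n : ℝ) / Real.sqrt n * max (a * x + c * y - Real.log n) 0
      ≤ ArithmeticFunction.vonMangoldt n / Real.sqrt n *
          (a * max (x - Real.log n) 0 + c * max (y - Real.log n) 0) :=
        mul_le_mul_of_nonneg_left h hc0
    _ = a * (ArithmeticFunction.vonMangoldt n / Real.sqrt n * max (x - Real.log n) 0)
          + c * (ArithmeticFunction.vonMangoldt n / Real.sqrt n * max (y - Real.log n) 0) := by
        ring

/-- `t ↦ e^{l t}` is convex on `ℝ` for every real `l`. [folklore] -/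
private theorem convexOn_exp_mul (l : ℝ) : ConvexOn ℝ univ (fun t : ℝ => Real.exp (l * t)) := by
  refine ⟨convex_univ, fun x _ y _ a b ha hb hab => ?_⟩
  have h := convexOn_exp.2 (mem_univ (l * x)) (mem_univ (l * y)) ha hb hab
  simp only [smul_eq_mul] at h ⊢
  convert h using 2
  ring

/-- The Hurwitz–Lerch term `t ↦ e^{-t/2} Φ(e^{-2t}, 2, 1/4) = ∑_k e^{-(2k+1/2)t} (k+1/4)^{-2}` is
convex on `[0, ∞)` (a convergent sum of convex exponentials; this is the Hurwitz–Lerch term of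
Suzuki2023 (1.1)). [cite: Suzuki2023, (1.1)] -/
theorem convexOn_exp_mul_hurwitzLerchQuarter :
    ConvexOn ℝ (Ici 0) (fun t : ℝ => Real.exp (-(t / 2)) * hurwitzLerchQuarter t) := by
  refine ⟨convex_Ici 0, fun x hx y hy a b ha hb hab => ?_⟩
  have hz : 0 ≤ a * x + b * y := by
    have hx' : (0 : ℝ) ≤ x := hx
    have hy' : (0 : ℝ) ≤ y := hy
    positivity
  simp only [smul_eq_mul]
  unfold hurwitzLerchQuarter
  rw [abs_of_nonneg hz, abs_of_nonneg (show (0:ℝ) ≤ x from hx),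
    abs_of_nonneg (show (0:ℝ) ≤ y from hy)]
  have hsx := summable_hurwitzLerchQuarter x
  have hsy := summable_hurwitzLerchQuarter y
  have hsz := summable_hurwitzLerchQuarter (a * x + b * y)
  rw [abs_of_nonneg hz] at hsz
  rw [abs_of_nonneg (show (0:ℝ) ≤ x from hx)] at hsx
  rw [abs_of_nonneg (show (0:ℝ) ≤ y from hy)] at hsy
  rw [← tsum_mul_left, ← tsum_mul_left, ← tsum_mul_left, ← tsum_mul_left, ← tsum_mul_left,
    ← (hsx.mul_left _ |>.mul_left _).tsum_add (hsy.mul_left _ |>.mul_left _)]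
  refine (hsz.mul_left _).tsum_le_tsum (fun k => ?_)
    ((hsx.mul_left _ |>.mul_left _).add (hsy.mul_left _ |>.mul_left _))
  -- termwise: convexity of `t ↦ exp (-(1/2 + 2k) t)`
  have hk : (0 : ℝ) < ((k : ℝ) + 1 / 4) ^ 2 := by positivity
  have hconv := (convexOn_exp_mul (-(1 / 2 + 2 * (k : ℝ)))).2 (mem_univ x) (mem_univ y) ha hb hab
  simp only [smul_eq_mul] at hconv
  have e1 : ∀ s : ℝ, Real.exp (-(s / 2)) * (Real.exp (-(2 * s * k)) / ((k : ℝ) + 1 / 4) ^ 2)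
      = Real.exp (-(1 / 2 + 2 * (k : ℝ)) * s) / ((k : ℝ) + 1 / 4) ^ 2 := by
    intro s
    rw [mul_div_assoc', ← Real.exp_add]
    congr 2
    ring
  rw [e1, e1, e1, div_le_iff₀ hk]
  calc Real.exp (-(1 / 2 + 2 * (k : ℝ)) * (a * x + b * y))
      ≤ a * Real.exp (-(1 / 2 + 2 * (k : ℝ)) * x) + b * Real.exp (-(1 / 2 + 2 * (k : ℝ)) * y) :=
        hconv
    _ = (a * (Real.exp (-(1 / 2 + 2 * (k : ℝ)) * x) / ((k : ℝ) + 1 / 4) ^ 2)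
          + b * (Real.exp (-(1 / 2 + 2 * (k : ℝ)) * y) / ((k : ℝ) + 1 / 4) ^ 2))
          * ((k : ℝ) + 1 / 4) ^ 2 := by
        field_simp



/-! ## Semiconcavity of `Ψ` on a window `[a, b] ⊆ [0, ∞)` -/

/-- **Prime-side semiconcavity of `Ψ`.**  For `0 ≤ a` and `M ≥ e^{b/2} + 1`, the function
`t ↦ Ψ(t) - M t²/2` is concave on `[a, b]`: by Suzuki2023 (1.1),
`Ψ = (4(e^{t/2}+e^{-t/2}-2) - c₀ t/2 + C/4) - φ(t) - ¼ e^{-t/2} Φ(e^{-2t},2,¼)` with the bracket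
smooth of second derivative `e^{t/2} + e^{-t/2} ≤ M` on `[a, b]`, the prime hinge sum `φ` convex and
the Hurwitz–Lerch term convex. [cite: Suzuki2023, (1.1)] -/
theorem concaveOn_zetaScrew_sub_quad {a b M : ℝ} (ha : 0 ≤ a) (hM : Real.exp (b / 2) + 1 ≤ M) :
    ConcaveOn ℝ (Icc a b) (fun t : ℝ => zetaScrew t - M / 2 * t ^ 2) := by
  set c₀ : ℝ := Real.eulerMascheroniConstant + Real.pi / 2 + 3 * Real.log 2 + Real.log Real.pi
    with hc₀
  set C : ℝ := ∑' k : ℕ, 1 / ((k : ℝ) + 1 / 4) ^ 2 with hC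
  have hsub0 : Icc a b ⊆ Ici 0 := fun t ht => by
    simp only [mem_Ici]; linarith [ht.1]
  have hsub1 : Icc a b ⊆ Icc 0 b := fun t ht => ⟨by linarith [ht.1], ht.2⟩
  -- the smooth part minus the quadratic is concave
  have h1 : ConcaveOn ℝ (Icc a b) (fun t : ℝ =>
      4 * (Real.exp (t / 2) + Real.exp (-(t / 2)) - 2) + (-(c₀ / 2)) * t + C / 4 - M / 2 * t ^ 2) :=
    concaveOn_arch_sub_quad (-(c₀ / 2)) (C / 4) ha hM
  -- the prime sum plus the Hurwitz–Lerch term is convex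
  have h2 : ConvexOn ℝ (Icc a b) (fun t : ℝ =>
      zetaScrewPrimeSum t + (1 / 4) * (Real.exp (-(t / 2)) * hurwitzLerchQuarter t)) :=
    ((convexOn_zetaScrewPrimeSum b).subset hsub1 (convex_Icc _ _)).add
      ((convexOn_exp_mul_hurwitzLerchQuarter.subset hsub0 (convex_Icc _ _)).smul
        (by norm_num : (0 : ℝ) ≤ 1 / 4))
  refine (h1.sub h2).congr fun t ht => ?_
  have ht0 : 0 ≤ t := hsub0 ht
  simp only [Pi.sub_apply]
  rw [zetaScrew_eq t, abs_of_nonneg ht0]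
  ring

/-- A concave function on a real set admits a supergradient at every interior point:
`Q(t) ≤ Q(t₀) + q (t - t₀)` on the set (take `-q` = the right derivative of the convex `-Q`).
[folklore] -/
private theorem exists_supergradient_of_concaveOn {D : Set ℝ} {Q : ℝ → ℝ} {t₀ : ℝ}
    (hQ : ConcaveOn ℝ D Q) (ht₀ : t₀ ∈ interior D) :
    ∃ q : ℝ, ∀ t ∈ D, Q t ≤ Q t₀ + q * (t - t₀) := by
  have hF : ConvexOn ℝ D (-Q) := hQ.neg
  set p : ℝ := derivWithin (-Q) (Ioi t₀) t₀ with hp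
  refine ⟨-p, fun t ht => ?_⟩
  rcases lt_trichotomy t₀ t with hlt | heq | hgt
  · have h := hF.rightDeriv_le_slope_of_mem_interior ht₀ ht hlt
    rw [← hp, slope_def_field] at h
    simp only [Pi.neg_apply] at h
    rw [le_div_iff₀ (sub_pos.2 hlt)] at h
    linarith
  · subst heq; simp
  · have h := hF.slope_le_leftDeriv_of_mem_interior ht ht₀ hgt
    have h' := hF.leftDeriv_le_rightDeriv_of_mem_interior ht₀
    rw [← hp] at h'
    rw [slope_def_field] at h
    simp only [Pi.neg_apply] at h
    rw [div_le_iff₀ (sub_pos.2 hgt)] at h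
    nlinarith

/-- **One-sided Taylor bound for `Ψ` on a window.**  For `0 ≤ a`, `M ≥ e^{b/2} + 1` and an interior
base point `t₀ ∈ (a, b)` there is a slope `p` with
`Ψ(t) ≤ Ψ(t₀) + p (t - t₀) + ½ M (t - t₀)²` for all `t ∈ [a, b]`. [cite: Suzuki2023, (1.1)] -/
theorem zetaScrew_le_taylor_of_mem_Ioo {a b M t₀ : ℝ} (ha : 0 ≤ a)
    (hM : Real.exp (b / 2) + 1 ≤ M) (ht₀ : t₀ ∈ Ioo a b) :
    ∃ p : ℝ, ∀ t ∈ Icc a b,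
      zetaScrew t ≤ zetaScrew t₀ + p * (t - t₀) + M / 2 * (t - t₀) ^ 2 := by
  have hint : t₀ ∈ interior (Icc a b) := by
    rw [interior_Icc]; exact ht₀
  obtain ⟨q, hq⟩ := exists_supergradient_of_concaveOn (concaveOn_zetaScrew_sub_quad ha hM) hint
  refine ⟨q + M * t₀, fun t ht => ?_⟩
  have h := hq t ht
  have e : M / 2 * t ^ 2 - M / 2 * t₀ ^ 2 = M * t₀ * (t - t₀) + M / 2 * (t - t₀) ^ 2 := by ring
  linarith

/-- **One-sided Taylor bound on the unit window** (the form used by the rh-split screw doors): for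
`t₀ ≥ 1` there is a slope `p` with `Ψ(t) ≤ Ψ(t₀) + p (t - t₀) + ½ (e^{(t₀+1)/2} + 1) (t - t₀)²` for
all `t` with `t₀ - 1 ≤ t ≤ t₀ + 1`. [cite: Suzuki2023, (1.1)] -/
theorem zetaScrew_le_taylor_unit {t₀ : ℝ} (ht₀ : 1 ≤ t₀) :
    ∃ p : ℝ, ∀ t : ℝ, t₀ - 1 ≤ t → t ≤ t₀ + 1 →
      zetaScrew t ≤ zetaScrew t₀ + p * (t - t₀)
        + (Real.exp ((t₀ + 1) / 2) + 1) / 2 * (t - t₀) ^ 2 := by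
  obtain ⟨p, hp⟩ := zetaScrew_le_taylor_of_mem_Ioo (a := t₀ - 1) (b := t₀ + 1)
    (M := Real.exp ((t₀ + 1) / 2) + 1) (by linarith) le_rfl ⟨by linarith, by linarith⟩
  exact ⟨p, fun t h1 h2 => hp t ⟨h1, h2⟩⟩

/-! ## The width law of negative excursions -/

/-- **Width law (one-sided excursion window).**  Let `0 ≤ a`, `M ≥ e^{b/2} + 1`, `D > 0`,
`δ = √(2D/M)`, and let `t₀ ∈ (a, b)` with `[t₀ - δ, t₀ + δ] ⊆ [a, b]`.  If `Ψ(t₀) ≤ -2D` then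
`Ψ ≤ -D` on `[t₀, t₀ + δ]` or on `[t₀ - δ, t₀]`: on the side where the supergradient term
`p (t - t₀)` is `≤ 0`, the quadratic term is at most `½ M δ² = D`. [cite: Suzuki2023, (1.1)] -/
theorem zetaScrew_excursion_window_of_mem {a b M D t₀ : ℝ} (ha : 0 ≤ a)
    (hM : Real.exp (b / 2) + 1 ≤ M) (hD : 0 < D) (ht₀ : t₀ ∈ Ioo a b)
    (hl : a ≤ t₀ - Real.sqrt (2 * D / M)) (hr : t₀ + Real.sqrt (2 * D / M) ≤ b)
    (hΨ : zetaScrew t₀ ≤ -(2 * D)) :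
    (∀ t ∈ Icc t₀ (t₀ + Real.sqrt (2 * D / M)), zetaScrew t ≤ -D) ∨
    (∀ t ∈ Icc (t₀ - Real.sqrt (2 * D / M)) t₀, zetaScrew t ≤ -D) := by
  have hMpos : 0 < M := by
    have := Real.exp_pos (b / 2)
    linarith
  have hq : 0 < 2 * D / M := div_pos (by linarith) hMpos
  set δ : ℝ := Real.sqrt (2 * D / M) with hδ
  have hδsq : δ ^ 2 = 2 * D / M := Real.sq_sqrt hq.le
  have hquad : ∀ t : ℝ, (t - t₀) ^ 2 ≤ δ ^ 2 → M / 2 * (t - t₀) ^ 2 ≤ D := by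
    intro t ht
    calc M / 2 * (t - t₀) ^ 2 ≤ M / 2 * δ ^ 2 := by gcongr
      _ = D := by rw [hδsq]; field_simp
  obtain ⟨p, hp⟩ := zetaScrew_le_taylor_of_mem_Ioo ha hM ht₀
  rcases le_or_gt p 0 with hp0 | hp0
  · refine Or.inl fun t ht => ?_
    have hT := hp t ⟨by linarith [ht.1, ht₀.1], by linarith [ht.2]⟩
    have hsq : (t - t₀) ^ 2 ≤ δ ^ 2 :=
      pow_le_pow_left₀ (by linarith [ht.1]) (by linarith [ht.2]) 2
    have hlin : p * (t - t₀) ≤ 0 := mul_nonpos_of_nonpos_of_nonneg hp0 (by linarith [ht.1])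
    have := hquad t hsq
    linarith
  · refine Or.inr fun t ht => ?_
    have hT := hp t ⟨by linarith [ht.1], by linarith [ht.2, ht₀.2]⟩
    have hsq : (t - t₀) ^ 2 ≤ δ ^ 2 := by
      rw [← neg_sq, neg_sub]
      exact pow_le_pow_left₀ (by linarith [ht.2]) (by linarith [ht.1]) 2
    have hlin : p * (t - t₀) ≤ 0 := mul_nonpos_of_nonneg_of_nonpos hp0.le (by linarith [ht.2])
    have := hquad t hsq
    linarith

end ZetaScrewSemiconcave

end Literature.NumberTheory.LFunctions

end
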